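import Summits.QuantumFields.YangMills.Theorems.UnitScaleTiltProp7CoerciveRawSlotOfGaugeFixedLift
import Summits.QuantumFields.YangMills.Theorems.UnitScaleTiltProp7TJL2BoundOfSupRow
import HarnessLib

/-!
# Route `UnitScaleTilt`, crux «MinimiserStabilityRegPr» (stmt-QuantumFields-19200, stub EX), node N06(d = 3), route (α) — **THE POSITIVITY-BLOCK DOOR OF THE EX FACE
# WITH BOTH OF ITS ANALYTIC ROWS BEHIND THE LIFT ANTECEDENT: the three [B9] Thm 3.11 print rows `hPos₁ hPosπ hPosΔ` IN THEIR LIFT-THREAD 2 TEXTS FROM THE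
# LIFTED GAUGE-FIXED SLICE ROW `γ`, THE LIFTED SUP-ROW `hTJ`, THE LIFT ROW `hLiftRec`, AND NUMERIC WINDOWS** (EX namer w2 g11, 2026-08-29; door (D-γ) of the «γ-TRADE»)

Cell `ym3-torus` (HUMAN RULING D-0037, YM ladder rung R3 — YM₃ on T³ is a RUNG, NOT d = 4, NOT the Clay problem; the YM mass gap is NOT proved).  Width seat
`ym-ust-19200-w2` (EX namer lineage, gen 11).  THEOREMS ONLY (0 `def`, 0 `sorry`); `--supports stmt-QuantumFields-19200 --as helper`; count-neutral.

THE POINT.  ✓`Prop7PositivityBlockDoorLift.positivityRows_lift_of_gaugeFixedRow` (★p1 g22, p739107) trades the three displayed positivity rows of the EX face for ONE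
gauge-fixed slice row `hGF` + the `T_Jᴾ` sup-row `hTJ` + windows — but takes `hGF` and `hTJ` for EVERY `U₀ ∈ RegPr`, while the face (S43ᴸT2 ✓p740465) asks its print rows
only BEHIND the parallel-lift antecedent `Lift L i U₀ →` (LIFT-THREAD 2, ★★OWNER RULING №30), and the tree's supplier of `hTJ` is the LIFTED one
✓`Prop7TJRowOfEntry157Lift.hTJ_of_hHcol_h157 Lift …` (from the displayed, lifted `h133` and the landed `hC157_family`).  Every lemma under the door is pointwise in `U₀`
(✓`tauRow_TJP_of_supRow`, ✓`gaugeFixedFloor_add_of_bound`, ✓`coercive_laplaceA_rawSlot_of_gaugeFixed_of_lift`, ✓`pos_laplaceA_DeltaOnePJ_iff`, ✓`pos_laplaceA_DeltaPiSlotP_iff`),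
and each of the three conclusions already carries `Lift L i U₀` as a hypothesis — so the door holds VERBATIM with `Lift L i U₀ →` inserted in `hGF` (after `ρ ≤ αcap L →`)
and in `hTJ` (after `RegPr (αcap L) U₀ →`) AND NOTHING ELSE.  That is this file.  With it the EX namer's S44 («γ-TRADE») discharges `hTJ` by name and displays `hGF[Lift]`
in place of `hPos₁ hPosπ hPosΔ` without re-displaying any retired row.

THE PRINT.  [Balaban1985BackgroundPropagators] Thm 3.11 p. 416 *«the operators Δ′_a, G′, (Q′G′²Q′*)⁻¹, Δ_a, G are positive definite»*; (3.118)–(3.122) pp. 419–420 (gauge-fixed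
reduction); (3.127)–(3.128) p. 421 (`Δ₁ = Pᵀ(Δ + T_J)P`); (3.26) p. 395; Thm 3.3 p. 399 (the slice floor `γ₀`).  [Balaban1985Variational] (141)–(142) p. 299.

WHAT IS PROVED (ns `…Theorems.Prop7PositivityBlockDoorLiftedRows`).
* ★★★ `positivityRows_lift_of_liftedRows` — for an OPAQUE lift letter `Lift` with `hLiftRec : Lift L i U₀ → ⟨lifting predicate of record⟩`, a cap `αcap` with `10¹²L³·αcap L ≤ 1`,
  the LIFTED gauge-fixed slice row `hGF : ∀ ρ ≤ αcap L, RegPr ρ U₀ → Lift L i U₀ → ∀ A, R_S D* A = 0 → γ L i‖A‖² ≤ re⟨A, Δ^η(U₀)A⟩ + a‖Q_kA‖²`, the LIFTED sup-row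
  `hTJ : RegPr (αcap L) U₀ → Lift L i U₀ → …` of `T_Jᴾ` (constant `kTJ L ≥ 0`), and the member windows `hwin₁ : 4 kTJ L + 1029 αcap L ≤ γ L i`,
  `hwin₂ : 288 (αcap L)² + 4 kTJ L ≤ 1`, `hwin₃ : 4·1029·αcap L < min (γ L i − 4 kTJ L − 1029 αcap L) (1 − 288 (αcap L)² − 4 kTJ L)`:
  THE CONJUNCTION `hPos₁[Lift] ∧ hPosπ[Lift] ∧ hPosΔ[Lift]` of the three S43ᴸT2 binder texts (slots `DeltaOnePJ`, `DeltaPiSlotP`, `DeltaEtaSlot + TJSlotP`) — IDENTICAL to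
  the conclusion of ✓`positivityRows_lift_of_gaugeFixedRow`.  Proof = that theorem's, pointwise: under `hl : Lift L i U₀` the τ-row of `T_Jᴾ` is ✓`tauRow_TJP_of_supRow` fed with
  `hTJ … hl`, the slice floor `γ − kTJ` at `Δ^η + T_J` is ✓`gaugeFixedFloor_add_of_bound`, `hPos₁`∕`hPosπ` are ✓`pos_laplaceA_DeltaOnePJ_iff`∕✓`pos_laplaceA_DeltaPiSlotP_iff`,
  `hPosΔ` is ✓`coercive_laplaceA_rawSlot_of_gaugeFixed_of_lift` with `T := TJSlotP`, `τ := kTJ L`, floor `γ L i − kTJ L`, positivity of its constant from `hwin₃`.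
HONEST SCOPE.  Composition; no estimate of print is proved; the γ-row (= Thm 3.3∕3.11 proper), `h133`∕`hC157` (behind `hTJ`), the other print rows, `hThm2S`, EX, the crux
are NOT proved; nothing continuum ∕ OS ∕ mass-gap ∕ Clay.

References: T. Bałaban, CMP **99** (1985) 389–434 [Balaban1985BackgroundPropagators] (Thm 3.3 p.399, Thm 3.11 p.416, (3.26) p.395, (3.118)–(3.122) pp.419–420,
(3.127)–(3.128) p.421); CMP **102** (1985) 277–309 [Balaban1985Variational] ((141)–(142) p.299).
-/

set_option autoImplicit false

noncomputable section

open scoped InnerProductSpace ComplexConjugate Matrix.Norms.L2Operator BigOperators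

namespace Summit.QuantumFields.YangMills.Theorems.Prop7PositivityBlockDoorLiftedRows

open Literature.MathematicalPhysics.QuantumFieldTheory.Balaban1983to89
open Literature.MathematicalPhysics.QuantumFieldTheory.Balaban1983to89.T3ContinuumYM3Torus
open Literature.MathematicalPhysics.QuantumFieldTheory.Balaban1983to89.T3PrintedRegularMinimiser (RegPr)
open Literature.MathematicalPhysics.QuantumFieldTheory.Balaban1983to89.T3Thm1Carrier (Idx)
open T4Continuum BlockAveraging
open T3SectALandauChart (bgUnits eta eta_pos)
open B11Eq103H1Complex (BondL2K)
open B15DeterminingSets (embIter)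
open Summit.QuantumFields.YangMills.Theorems.Prop8Chart (emlIterU)
open Summit.QuantumFields.YangMills.Theorems.Prop7SectET3Transport (periodsT3)
open Summit.QuantumFields.YangMills.Theorems.Prop7SectET3HilbertLetters (W₂ toL2 DstarL2)
open Summit.QuantumFields.YangMills.Theorems.Prop7SectET3GaugeProjector (RS)
open Summit.QuantumFields.YangMills.Theorems.Prop7SectET3WilsonHessian (DeltaEta DeltaEtaSlot)
open Summit.QuantumFields.YangMills.Theorems.Prop7SectET3CurvedPropagators (Qk laplaceA)
open Summit.QuantumFields.YangMills.Theorems.Prop7SectET3DeltaPiPInv (DeltaPiSlotP)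
open Summit.QuantumFields.YangMills.Theorems.Prop7SectET3DeltaOnePInv (DeltaOnePJ TJSlotP)
open Summit.QuantumFields.YangMills.Theorems.Prop7PosOfGaugeFixed (pos_laplaceA_DeltaPiSlotP_iff pos_laplaceA_DeltaOnePJ_iff)
open Summit.QuantumFields.YangMills.Theorems.Prop7CoerciveRawSlotOfGaugeFixedLift (coercive_laplaceA_rawSlot_of_gaugeFixed_of_lift gaugeFixedFloor_add_of_bound)
open Summit.QuantumFields.YangMills.Theorems.Prop7TJL2BoundOfSupRow (tauRow_TJP_of_supRow)

/-- ★★★ **THE POSITIVITY BLOCK OF THE EX FACE, LIFT-THREAD 2 TEXTS, FROM THE LIFTED γ-ROW + THE LIFTED SUP-ROW `hTJ` + `hLiftRec` + WINDOWS.**  Statement =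
✓`Prop7PositivityBlockDoorLift.positivityRows_lift_of_gaugeFixedRow` with `Lift L i U₀ →` inserted in `hGF` (after `ρ ≤ αcap L →`) and in `hTJ` (after `RegPr (αcap L) U₀ →`),
nothing else; conclusion = the conjunction of the three S43ᴸT2 binders `hPos₁` ∧ `hPosπ` ∧ `hPosΔ` (each: `∀ L > 1, ∀ i U₀ ρ, RegPr ρ U₀ → ρ ≤ αcap L → Lift L i U₀ → ∀ x ≠ 0,
0 < re⟨x, laplaceA … (slot) U₀ x⟩`, slots `DeltaOnePJ`, `DeltaPiSlotP`, `DeltaEtaSlot + TJSlotP`).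
[cite: Balaban1985BackgroundPropagators, Thm 3.11 p.416, Thm 3.3 p.399, (3.118)–(3.122) pp.419–420, (3.127)–(3.128) p.421; Balaban1985Variational, (141)–(142) p.299] -/
theorem positivityRows_lift_of_liftedRows
    (Lift : ∀ (L : ℕ) (i : Idx L), GaugeField (i.1.1.P i.1.2.2) 0 (Matrix.specialUnitaryGroup (Fin 2) ℂ) → Prop)
    (hLiftRec : ∀ (L : ℕ) (i : Idx L) (U₀ : GaugeField (i.1.1.P i.1.2.2) 0 (Matrix.specialUnitaryGroup (Fin 2) ℂ)), Lift L i U₀ →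
      ∀ cf : Site (i.1.1.P i.1.2.2) (i.1.2.2 - i.1.2.1) → Matrix (Fin 2) (Fin 2) ℂ,
        (∀ e' : PBond (i.1.1.P i.1.2.2) (i.1.2.2 - i.1.2.1), cf e'.src = ((emlIterU (i.1.2.2 - i.1.2.1) (bgUnits i.1.1 i.1.2.2 U₀) e' : (Matrix (Fin 2) (Fin 2) ℂ)ˣ) : Matrix (Fin 2) (Fin 2) ℂ) * cf e'.tgt *
          (((emlIterU (i.1.2.2 - i.1.2.1) (bgUnits i.1.1 i.1.2.2 U₀) e')⁻¹ : (Matrix (Fin 2) (Fin 2) ℂ)ˣ) : Matrix (Fin 2) (Fin 2) ℂ)) →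
        ∃ l₀ : Site (i.1.1.P i.1.2.2) 0 → Matrix (Fin 2) (Fin 2) ℂ,
          (∀ b' : PBond (i.1.1.P i.1.2.2) 0, l₀ b'.src = ((bgUnits i.1.1 i.1.2.2 U₀ b' : (Matrix (Fin 2) (Fin 2) ℂ)ˣ) : Matrix (Fin 2) (Fin 2) ℂ) * l₀ b'.tgt * (((bgUnits i.1.1 i.1.2.2 U₀ b')⁻¹ : (Matrix (Fin 2) (Fin 2) ℂ)ˣ) : Matrix (Fin 2) (Fin 2) ℂ)) ∧
          ∀ y : Site (i.1.1.P i.1.2.2) (i.1.2.2 - i.1.2.1), l₀ (embIter (i.1.2.2 - i.1.2.1) y) = cf y)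
    (αcap : ℕ → ℝ) (hαcap : ∀ L : ℕ, 1 < L → 0 < αcap L) (hαW : ∀ L : ℕ, 1 < L → 10 ^ 12 * (L : ℝ) ^ 3 * αcap L ≤ 1)
    (c₀ cB : ℕ → ℝ) [hc₀ : ∀ L : ℕ, Fact (0 < c₀ L)] [hcB : ∀ L : ℕ, Fact (0 < cB L)]
    (a : ∀ L : ℕ, Idx L → ℝ) (ha : ∀ (L : ℕ) (i : Idx L), 0 < a L i)
    (γ : ∀ L : ℕ, Idx L → ℝ) (kTJ : ℕ → ℝ) (hkTJ : ∀ L : ℕ, 1 < L → 0 ≤ kTJ L)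
    (hwin₁ : ∀ (L : ℕ) (i : Idx L), 1 < L → 4 * kTJ L + 1029 * αcap L ≤ γ L i)
    (hwin₂ : ∀ (L : ℕ) (i : Idx L), 1 < L → 288 * αcap L ^ 2 + 4 * kTJ L ≤ 1)
    (hwin₃ : ∀ (L : ℕ) (i : Idx L), 1 < L → 4 * (1029 * αcap L) < min (γ L i - 4 * kTJ L - 1029 * αcap L) (1 - 288 * αcap L ^ 2 - 4 * kTJ L))
    -- THE LIFTED γ-ROW: the gauge-fixed slice floor of `Δ^η(U₀) + a·Q_k†Q_k` on `{R_S(U₀) D*_{U₀} A = 0}` BEHIND `Lift L i U₀` ([B9] Thm 3.3 ∕ Thm 3.11 in gauge-fixed form)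
    (hGF : ∀ (L : ℕ), 1 < L → ∀ (i : Idx L) (U₀ : GaugeField (i.1.1.P i.1.2.2) 0 (Matrix.specialUnitaryGroup (Fin 2) ℂ)), ∀ ρ : ℝ,
      RegPr i.1.1 i.1.2.1 i.1.2.2 ρ U₀ → ρ ≤ αcap L → Lift L i U₀ →
        ∀ A : BondL2K ℂ 3 (periodsT3 i.1.1 i.1.2.2) (c₀ L) W₂,
          RS i.1.1 i.1.2.1 i.1.2.2 i.2.2.le (c₀ L) (cB L) U₀ (DstarL2 i.1.1 i.1.2.1 i.1.2.2 (c₀ L) U₀ A) = 0 →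
            γ L i * ‖A‖ ^ 2 ≤ RCLike.re ⟪A, DeltaEta i.1.1 i.1.2.1 i.1.2.2 (c₀ L) U₀ A⟫_ℂ + a L i * ‖Qk i.1.1 i.1.2.1 i.1.2.2 i.2.2.le (c₀ L) (cB L) U₀ A‖ ^ 2)
    -- THE LIFTED SUP-ROW OF `T_Jᴾ` (the conclusion text of ✓`Prop7TJRowOfEntry157Lift.hTJ_of_hHcol_h157` at radius `αcap L`, constant `kTJ L`)
    (hTJ : ∀ (L : ℕ), 1 < L → ∀ (i : Idx L) (U₀ : GaugeField (i.1.1.P i.1.2.2) 0 (Matrix.specialUnitaryGroup (Fin 2) ℂ)), RegPr i.1.1 i.1.2.1 i.1.2.2 (αcap L) U₀ →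
      Lift L i U₀ →
      ∀ (X : PBond (i.1.1.P i.1.2.2) 0 → Matrix (Fin 2) (Fin 2) ℂ) (s : ℝ), (∀ bd, ‖X bd‖ ≤ s) →
        ∀ bd : PBond (i.1.1.P i.1.2.2) 0, ‖(toL2 i.1.1 i.1.2.2 (c₀ L)).symm (TJSlotP i.1.1 i.1.2.1 i.1.2.2 i.2.2.le (c₀ L) (cB L) (a L i) U₀ (toL2 i.1.1 i.1.2.2 (c₀ L) X)) bd‖ ≤ kTJ L * s) :
    -- `hPos₁[Lift]`
    (∀ (L : ℕ), 1 < L → ∀ (i : Idx L) (U₀ : GaugeField (i.1.1.P i.1.2.2) 0 (Matrix.specialUnitaryGroup (Fin 2) ℂ)), ∀ ρ : ℝ, RegPr i.1.1 i.1.2.1 i.1.2.2 ρ U₀ → ρ ≤ αcap L →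
      Lift L i U₀ →
      ∀ x : BondL2K ℂ 3 (periodsT3 i.1.1 i.1.2.2) (c₀ L) W₂, x ≠ 0 →
        0 < RCLike.re ⟪x, laplaceA i.1.1 i.1.2.1 i.1.2.2 i.2.2.le (c₀ L) (cB L) (a L i) (DeltaOnePJ i.1.1 i.1.2.1 i.1.2.2 i.2.2.le (c₀ L) (cB L) (a L i)) U₀ x⟫_ℂ) ∧
    -- `hPosπ[Lift]`
    (∀ (L : ℕ), 1 < L → ∀ (i : Idx L) (U₀ : GaugeField (i.1.1.P i.1.2.2) 0 (Matrix.specialUnitaryGroup (Fin 2) ℂ)), ∀ ρ : ℝ, RegPr i.1.1 i.1.2.1 i.1.2.2 ρ U₀ → ρ ≤ αcap L →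
      Lift L i U₀ →
      ∀ x : BondL2K ℂ 3 (periodsT3 i.1.1 i.1.2.2) (c₀ L) W₂, x ≠ 0 →
        0 < RCLike.re ⟪x, laplaceA i.1.1 i.1.2.1 i.1.2.2 i.2.2.le (c₀ L) (cB L) (a L i) (DeltaPiSlotP i.1.1 i.1.2.1 i.1.2.2 i.2.2.le (c₀ L) (cB L) (a L i)) U₀ x⟫_ℂ) ∧
    -- `hPosΔ[Lift]`
    (∀ (L : ℕ), 1 < L → ∀ (i : Idx L) (U₀ : GaugeField (i.1.1.P i.1.2.2) 0 (Matrix.specialUnitaryGroup (Fin 2) ℂ)), ∀ ρ : ℝ, RegPr i.1.1 i.1.2.1 i.1.2.2 ρ U₀ → ρ ≤ αcap L →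
      Lift L i U₀ →
      ∀ x : BondL2K ℂ 3 (periodsT3 i.1.1 i.1.2.2) (c₀ L) W₂, x ≠ 0 →
        0 < RCLike.re ⟪x, laplaceA i.1.1 i.1.2.1 i.1.2.2 i.2.2.le (c₀ L) (cB L) (a L i) ((DeltaEtaSlot i.1.1 i.1.2.1 i.1.2.2 (c₀ L) + TJSlotP i.1.1 i.1.2.1 i.1.2.2 i.2.2.le (c₀ L) (cB L) (a L i))) U₀ x⟫_ℂ) := by
  -- the τ-row of `T_Jᴾ(U₀)` from the lifted sup-row, pointwise in `U₀` behind `Lift` (symmetry of `T_Jᴾ` on `RegPr`: ✓`tauRow_TJP_of_supRow`)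
  have hτ : ∀ (L : ℕ), 1 < L → ∀ (i : Idx L) (U₀ : GaugeField (i.1.1.P i.1.2.2) 0 (Matrix.specialUnitaryGroup (Fin 2) ℂ)), ∀ ρ : ℝ,
      RegPr i.1.1 i.1.2.1 i.1.2.2 ρ U₀ → ρ ≤ αcap L → Lift L i U₀ →
        ∀ u v : BondL2K ℂ 3 (periodsT3 i.1.1 i.1.2.2) (c₀ L) W₂,
          ‖⟪u, TJSlotP i.1.1 i.1.2.1 i.1.2.2 i.2.2.le (c₀ L) (cB L) (a L i) U₀ v⟫_ℂ‖ ≤ kTJ L * ‖u‖ * ‖v‖ := by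
    intro L hL i U₀ ρ hreg hρ hl u v
    have hreg' : RegPr i.1.1 i.1.2.1 i.1.2.2 (αcap L) U₀ := T3PrintedMinimiserExistence.regPr_mono i.1.1 hρ hreg
    have hW : 10 ^ 12 * (i.1.1.L : ℝ) ^ 3 * αcap L ≤ 1 := by rw [i.2.1]; exact hαW L hL
    exact tauRow_TJP_of_supRow i.1.1 i.2.2.le (hαcap L hL) hW (ha L i).le U₀ hreg' (hkTJ L hL) (hTJ L hL i U₀ hreg' hl) u v
  -- the slice floor `γ − kTJ` at slot `Δ^η + T_J`, behind `Lift`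
  have hGF₁ : ∀ (L : ℕ), 1 < L → ∀ (i : Idx L) (U₀ : GaugeField (i.1.1.P i.1.2.2) 0 (Matrix.specialUnitaryGroup (Fin 2) ℂ)), ∀ ρ : ℝ,
      RegPr i.1.1 i.1.2.1 i.1.2.2 ρ U₀ → ρ ≤ αcap L → Lift L i U₀ →
        ∀ A : BondL2K ℂ 3 (periodsT3 i.1.1 i.1.2.2) (c₀ L) W₂,
          RS i.1.1 i.1.2.1 i.1.2.2 i.2.2.le (c₀ L) (cB L) U₀ (DstarL2 i.1.1 i.1.2.1 i.1.2.2 (c₀ L) U₀ A) = 0 →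
            (γ L i - kTJ L) * ‖A‖ ^ 2 ≤ RCLike.re ⟪A, DeltaEta i.1.1 i.1.2.1 i.1.2.2 (c₀ L) U₀ A
                + TJSlotP i.1.1 i.1.2.1 i.1.2.2 i.2.2.le (c₀ L) (cB L) (a L i) U₀ A⟫_ℂ + a L i * ‖Qk i.1.1 i.1.2.1 i.1.2.2 i.2.2.le (c₀ L) (cB L) U₀ A‖ ^ 2 :=
    fun L hL i U₀ ρ hreg hρ hl =>
      gaugeFixedFloor_add_of_bound i.1.1 (h := i.2.2.le) (a := a L i) (fun U => TJSlotP i.1.1 i.1.2.1 i.1.2.2 i.2.2.le (c₀ L) (cB L) (a L i) U) U₀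
        (hτ L hL i U₀ ρ hreg hρ hl) (hGF L hL i U₀ ρ hreg hρ hl)
  refine ⟨?_, ?_, ?_⟩
  · -- `hPos₁`: slice positivity at `Δ^η + T_J` (floor `γ − kTJ > 0`)
    intro L hL i U₀ ρ hreg hρ hl x hx
    refine (pos_laplaceA_DeltaOnePJ_iff (ha L i).le U₀).2 (fun A hA hR => ?_) x hx
    have h1 := hGF₁ L hL i U₀ ρ hreg hρ hl A hR
    have hγ : 0 < γ L i - kTJ L := by
      have := hwin₁ L i hL; have := hkTJ L hL; have := hαcap L hL; linarith
    exact lt_of_lt_of_le (mul_pos hγ (pow_pos (norm_pos_iff.2 hA) 2)) h1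
  · -- `hPosπ`: slice positivity at `Δ^η` (floor `γ > 0`)
    intro L hL i U₀ ρ hreg hρ hl x hx
    refine (pos_laplaceA_DeltaPiSlotP_iff (ha L i).le U₀).2 (fun A hA hR => ?_) x hx
    have h1 := hGF L hL i U₀ ρ hreg hρ hl A hR
    have hγ : 0 < γ L i := by
      have := hwin₁ L i hL; have := hkTJ L hL; have := hαcap L hL; linarith
    exact lt_of_lt_of_le (mul_pos hγ (pow_pos (norm_pos_iff.2 hA) 2)) h1
  · -- `hPosΔ`: the raw-slot row behind `Lift` (✓`coercive_laplaceA_rawSlot_of_gaugeFixed_of_lift` with `T := TJSlotP`, `τ := kTJ L`, floor `γ − kTJ`), positive constant by `hwin₃`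
    intro L hL i U₀ ρ hreg hρ hl x hx
    have hreg' : RegPr i.1.1 i.1.2.1 i.1.2.2 (αcap L) U₀ := T3PrintedMinimiserExistence.regPr_mono i.1.1 hρ hreg
    have hW : 10 ^ 12 * (i.1.1.L : ℝ) ^ 3 * αcap L ≤ 1 := by rw [i.2.1]; exact hαW L hL
    have hw₁ : 3 * kTJ L + 1029 * αcap L ≤ γ L i - kTJ L := by have := hwin₁ L i hL; linarith
    have hrow := coercive_laplaceA_rawSlot_of_gaugeFixed_of_lift i.1.1 i.2.2.le (hαcap L hL) hW (ha L i).le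
      (fun U => TJSlotP i.1.1 i.1.2.1 i.1.2.2 i.2.2.le (c₀ L) (cB L) (a L i) U) U₀ hreg' (hLiftRec L i U₀ hl)
      (hkTJ L hL) (fun u v => hτ L hL i U₀ (αcap L) hreg' le_rfl hl u v) hw₁ (hwin₂ L i hL)
      (fun A hA => hGF₁ L hL i U₀ (αcap L) hreg' le_rfl hl A hA) x
    have e : γ L i - kTJ L - 3 * kTJ L - 1029 * αcap L = γ L i - 4 * kTJ L - 1029 * αcap L := by ring
    rw [e] at hrow
    have hc : 0 < min (γ L i - 4 * kTJ L - 1029 * αcap L) (1 - 288 * αcap L ^ 2 - 4 * kTJ L) / 4 - 1029 * αcap L := by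
      have := hwin₃ L i hL; linarith
    exact lt_of_lt_of_le (mul_pos hc (pow_pos (norm_pos_iff.2 hx) 2)) hrow

end Summit.QuantumFields.YangMills.Theorems.Prop7PositivityBlockDoorLiftedRows

end
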